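import Summits.BirchSwinnertonDyer.BirchSwinnertonDyer.Theses.RamifiedHeegnerPair
import Summits.BirchSwinnertonDyer.BirchSwinnertonDyer.Theorems.RamifiedHeegnerPairGss2LowerAtThreeRankOneMcCallumRoad
import Summits.BirchSwinnertonDyer.BirchSwinnertonDyer.Theorems.RamifiedHeegnerPairGss2LowerAtThreeRankOneNonTowerOfNonSurjThree
import Summits.BirchSwinnertonDyer.BirchSwinnertonDyer.Theorems.RamifiedHeegnerPairGss2LowerAtThreeRankOneIrreducibleRoad
import Summits.BirchSwinnertonDyer.BirchSwinnertonDyer.Theorems.RamifiedHeegnerPairLeafRankOneUpperAtThreeLeafTwistStable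
import Literature.NumberTheory.EllipticCurves.MatarNekovar2019.ShaStructureIrreducible
import HarnessLib

-- D-0017: single-problem summit, so `Summit.BirchSwinnertonDyer.BirchSwinnertonDyer.…` repeats a namespace BY DESIGN.
set_option linter.dupNamespace false
set_option autoImplicit false

noncomputable section

open scoped Classical NumberField

/-!
# Line `kolyvagin_split` for crux L₁ `Gss2LowerAtThreeRankOne` (stmt-BirchSwinnertonDyer-26021) — skeleton v5, the IRREDUCIBLE ROAD with
# the twist's upper half RESTRICTED to the `3Nn` rows (lead rhp-p1 g6; v4 = cecbb8355708e296 (g5), v3c 02f55c1a, v3 102a5bdc, v2 a8aa8cc0, v1 7278c851)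

WHAT CHANGED vs v4 (texts of `stub_pub` = PUB 27199, `stub_existsMcCallumCertificate_towerRows` = A 27200, `stub_structIrr`,
`stub_existsMcCallumCertificate_nonsplitRows` = A₃ₙₙ are UNCHANGED, byte-identical). v4's fifth stub `stub_leafRankZeroUpper` was the route's member
U₀ = item 26024 VERBATIM (ALL rank-`0` leaf rows). But the composition consumes U₀ ONLY at the rank-`0` twists `Wd = E^{(d_{K′})}` of the `3Nn`
rows, and such a twist is again a `3Nn` curve: `ρ̄_{Wd,3} ≅ ρ̄_{E,3} ⊗ χ_{d_{K′}}` is onto iff `ρ̄_{E,3}` is (Silverman X.5 Cor. 5.4; tree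
`twistAdmissible_hasSurjectiveModNGaloisRep_smul_quadraticTwist` read backwards through `exists_variableChange_quadraticTwist_symm`). On the
tower rows the twist's upper half is Kato 2004 Thm. 14.5 (3) + Prop. 14.16 (2) Tamagawa-exact (the last conjunct of `stub_pub`), i.e. PRINT. So v5
REPLACES `stub_leafRankZeroUpper` by `stub_leafRankZeroUpper_nonsplitRows` = U₀ RESTRICTED to the `3Nn` rank-`0` rows (`¬ ρ̄_{W,3}` onto added as
a binder): the registered stubs now display EXACTLY the coupling residual of memo IRREDUCIBLE-ROAD §6 / pen ruling 10:56:12Z — the one separated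
half U₀|3Nn (53 normaliser-image rank-`0` classes of the census; inside `EulerSystemBigImageBarrier`: Kato (12.5.2) fails there) — and nothing of
U₀ on the 652 other rank-`0` classes. `stub_leafRankZeroUpper_nonsplitRows` ⟸ item 26024 trivially (weaker statement); it is NOT an item.

-- v4 docstring (g5), kept for the record:

WHAT CHANGED vs v3c (texts of `stub_pub` = PUB 27199 and `stub_existsMcCallumCertificate_towerRows` = A 27200 are UNCHANGED, byte-identical
to the items). The v3c residual `stub_nonTowerRows` (= NT 27201: «L₁ on the Gss2 r1 rows without 3-adic tower surjectivity — no structure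
theorem in print there») is RETIRED and replaced by THREE stubs, because (kernel, this lead):
* the non-tower rows are EXACTLY the rows with `ρ̄_{E,3}` NOT onto = mod-3 image `C_ns⁺(3)` (`3Nn`), `E[3]` irreducible there
  (`Theorems/…NonTowerOfNonSurjThree.lean`, p622801/p623293: the tower is automatic on the (G) cell from surj(3));
* Kolyvagin's structure theorem holds under IRREDUCIBILITY with no reduction binder at `p` (Cha 2005 Thm. 21 / Rmk. 25; Matar–Nekovář
  2019 Thm. 0.7 read through §0.11) and is ALREADY IN THE TREE as the gate-accepted named fact
  `MatarNekovar2019.thm07_pow_dvd_card_sha_primary_of_certificate_of_irreducible` (cell bsd-potss; binders = the McCallum fact's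
  VERBATIM with the tower replaced by `Irr`) — stub `stub_structIrr` below takes it BY NAME (print; flags MN19-0.11-structure-composite /
  Kolyvagin1991-ThmCD-primary-unread travel with the fact);
* the McCallum road's only OTHER use of the tower — Kato 2004 Thm. 14.5 (3) + Prop. 14.16 (2) for the UPPER half of the rank-`0` twist
  `Wd = E^{(d_{K′})}` — is, for `Wd` on the SAME leaf (rhp-p2 `RamifiedPairUpperBound.leaf_twist_of_heegner`, odd `d_{K′}`), an instance
  of the route's OWN member U₀ = item 26024 `LeafRankZeroUpperAtThree` — stub `stub_leafRankZeroUpper` below = 26024 VERBATIM;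
* so on the `3Nn` rows L₁ needs only ONE derived-point certificate of adjusted BSD depth per row — stub
  `stub_existsMcCallumCertificate_nonsplitRows` (A₃ₙₙ) = the text of A 27200 with the tower binder replaced by `¬ CM ∧ ¬ ρ̄_{E,3} onto`
  and the frame asked with ODD `d_{K′}` — same currency, same per-pair instrument (Jetchev–Lauter–Stein), same research content (T1⁻
  at an additive `3`) (`Theorems/…IrreducibleRoad.lean` §8, p624620; by-name sequel `…IrreducibleRoadByName.lean`).

Stubs (5): `stub_pub` [= 27199, print] · `stub_existsMcCallumCertificate_towerRows` [= 27200, LOAD-BEARING research, surj(3) rows] ·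
`stub_structIrr` [NEW, print: the Matar–Nekovář fact by name] · `stub_existsMcCallumCertificate_nonsplitRows` [NEW, research: A₃ₙₙ,
the `3Nn` rows] · (v4) `stub_leafRankZeroUpper` [= item 26024 verbatim] ↦ (v5) `stub_leafRankZeroUpper_nonsplitRows` [U₀ on the `3Nn`
rank-`0` rows only]. Composition `Gss2LowerAtThreeRankOne_of` concludes the crux BY NAME: case split on `ρ̄_{E,3}` onto — onto ⟹ tower
(p622801 §1) ⟹ p618012 §12 with A; not onto ⟹ A₃ₙₙ gives an odd split frame + certificate, the twist is on the leaf with `r_an = 0` and is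
again `3Nn`, U₀|3Nn gives its upper half, and p624620 §8 gives L₁(E).
BSD is not proved by any of this; every stub is OPEN (27200 / A₃ₙₙ: research, T1⁻ at an additive `3`; U₀|3Nn: the route's residual member
26024 on its non-print rows; `stub_pub`, `stub_structIrr`: print, un-discharged in the tree).
-/

namespace Summit.BirchSwinnertonDyer.BirchSwinnertonDyer.Cruxes.Gss2LowerAtThreeRankOne.KolyvaginSplit

/-! ### The stub statements -/

/-- Statement of `stub_pub` = item 27199 `Gss2LowerPrintedInputsAtThree` (eleven named published facts) — UNCHANGED since v3. -/
def Sig.stub_pub : Prop :=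
  ((∀ (N : ℕ) [NeZero N] (W : WeierstrassCurve ℚ) (K : Type) [Field K] [NumberField K], Literature.NumberTheory.EllipticCurves.gross_zagier N W K) ∧ (∀ (N : ℕ) [NeZero N] (W : WeierstrassCurve ℚ) (K : Type) [Field K] [NumberField K], Literature.NumberTheory.EllipticCurves.kolyvagin N W K) ∧ (∀ (N : ℕ) [NeZero N] (W : WeierstrassCurve ℚ) (K : Type) [Field K] [NumberField K], Literature.NumberTheory.EllipticCurves.Kolyvagin1990_padicValNat_card_sha_le N W K) ∧ Literature.NumberTheory.EllipticCurves.rank_eq_analyticRank_of_analyticRank_le_one ∧ WeierstrassCurve.hasEntireLFunction_rat ∧ Literature.NumberTheory.EllipticCurves.ModularForms.exists_isNewformOf ∧ Literature.NumberTheory.EllipticCurves.HoffsteinLuo1997_exists_twist_L_one_ne_zero ∧ (∀ (N : ℕ) [NeZero N] (W : WeierstrassCurve ℚ) (K : Type) [Field K] [NumberField K], Literature.NumberTheory.EllipticCurves.heegnerPointOfConductor_one_galoisConj N W K) ∧ Literature.NumberTheory.EllipticCurves.McCallum1991_pow_dvd_card_sha_primary_of_certificate ∧ (∀ (N : ℕ)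 [NeZero N] (W : WeierstrassCurve ℚ) (K : Type) [Field K] [NumberField K], Literature.NumberTheory.EllipticCurves.phi_heegnerTau_mem_range_map_singularModuliField N W K)) ∧ Literature.NumberTheory.EllipticCurves.Kato2004.rankZero_padicValNat_sha_add_padicValNat_tamagawa_le_of_additive_potGood_of_imageContainsSL2

/-- Statement of `stub_existsMcCallumCertificate_towerRows` = item 27200 `Gss2RankOneMcCallumCertificateAtThreeTower` (LOAD-BEARING crux, McCallum
currency, the surj(3) = tower rows) — UNCHANGED since v3. -/
def Sig.stub_existsMcCallumCertificate_towerRows : Prop :=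
  ∀ (W : WeierstrassCurve ℚ) [W.IsElliptic] [W.IsGloballyMinimal], Literature.NumberTheory.EllipticCurves.Rank1Residual.Addv W 3 → Summit.BirchSwinnertonDyer.Rank1Residual.Additive.SubGss W 3 → W.analyticRank = 1 → (∀ n : ℕ, W.HasSurjectiveModNGaloisRep (3 ^ n : ℕ)) → ∃ (N : ℕ) (_ : NeZero N) (K : Type) (_ : Field K) (_ : NumberField K) (Dt : Literature.NumberTheory.EllipticCurves.ModularForms.ModularParametrizationData W N) (H : Literature.NumberTheory.EllipticCurves.HeegnerDatum N (NumberField.discr K)) (ι : K →+* ℂ) (P : (W.baseChange K).toAffine.Point) (Wd : WeierstrassCurve ℚ) (_ : Wd.IsElliptic) (_ : Wd.IsGloballyMinimal) (Cd : WeierstrassCurve.VariableChange ℚ) (M : ℕ), W.conductorNorm ℤ = N ∧ Literature.NumberTheory.EllipticCurves.IsImaginaryQuadratic K ∧ Literature.NumberTheory.EllipticCurves.SatisfiesHeegnerHypothesis N K ∧ (W.quadraticTwist (NumberField.discr K : ℚ)).entireLFunction 1 ≠ 0 ∧ WeierstrassCurve.Affine.Point.map ι.toRatAlgHom P = Literature.NumberTheory.EllipticCurves.ModularForms.heegnerPointComplex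 Dt H ∧ Cd • W.quadraticTwist (NumberField.discr K : ℚ) = Wd ∧ (2 * M : ℤ) ≤ padicValNat 3 W.tamagawaProduct + padicValNat 3 Wd.tamagawaProduct + 2 * padicValRat 3 (Dt.c : ℚ) ∧ Summit.BirchSwinnertonDyer.Rank1Residual.X11b.Three.Koly.CertificateAt Dt H.β ι 3 M

/-- Statement of `stub_structIrr` (NEW in v4, PRINT): Kolyvagin's structure theorem under IRREDUCIBILITY, certificate form, no reduction binder at
`p` — the tree's gate-accepted Literature named fact `MatarNekovar2019.thm07_pow_dvd_card_sha_primary_of_certificate_of_irreducible` BY NAME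
(Matar–Nekovář 2019 Thm. 0.7 / §0.11; Cha 2005 Rmk. 25; Kolyvagin 1991 Thm. C/D). -/
def Sig.stub_structIrr : Prop :=
  Literature.NumberTheory.EllipticCurves.MatarNekovar2019.thm07_pow_dvd_card_sha_primary_of_certificate_of_irreducible

/-- Statement of `stub_existsMcCallumCertificate_nonsplitRows` (NEW in v4, A₃ₙₙ, research): the text of A 27200 with the tower binder replaced by
`¬ CM` and `¬ ρ̄_{E,3}` onto (the `3Nn` rows, on which the mod-3 image is EXACTLY `C_ns⁺(3)` and `E[3]` is irreducible) and the frame asked with ODD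
`d_{K′}` — for every such row SOME odd split Heegner frame with SOME derived-point certificate of adjusted BSD depth. -/
def Sig.stub_existsMcCallumCertificate_nonsplitRows : Prop :=
  ∀ (W : WeierstrassCurve ℚ) [W.IsElliptic] [W.IsGloballyMinimal], ¬ W.HasCM → Literature.NumberTheory.EllipticCurves.Rank1Residual.Addv W 3 → Summit.BirchSwinnertonDyer.Rank1Residual.Additive.SubGss W 3 → W.analyticRank = 1 → ¬ W.HasSurjectiveModNGaloisRep 3 → ∃ (N : ℕ) (_ : NeZero N) (K : Type) (_ : Field K) (_ : NumberField K) (Dt : Literature.NumberTheory.EllipticCurves.ModularForms.ModularParametrizationData W N) (H : Literature.NumberTheory.EllipticCurves.HeegnerDatum N (NumberField.discr K)) (ι : K →+* ℂ) (P : (W.baseChange K).toAffine.Point) (Wd : WeierstrassCurve ℚ) (_ : Wd.IsElliptic) (_ : Wd.IsGloballyMinimal) (Cd : WeierstrassCurve.VariableChange ℚ) (M : ℕ), W.conductorNorm ℤ = N ∧ Literature.NumberTheory.EllipticCurves.IsImaginaryQuadratic K ∧ Odd (NumberField.discr K) ∧ Literature.NumberTheory.EllipticCurves.SatisfiesHeegnerHypothesis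 N K ∧ (W.quadraticTwist (NumberField.discr K : ℚ)).entireLFunction 1 ≠ 0 ∧ WeierstrassCurve.Affine.Point.map ι.toRatAlgHom P = Literature.NumberTheory.EllipticCurves.ModularForms.heegnerPointComplex Dt H ∧ Cd • W.quadraticTwist (NumberField.discr K : ℚ) = Wd ∧ (2 * M : ℤ) ≤ padicValNat 3 W.tamagawaProduct + padicValNat 3 Wd.tamagawaProduct + 2 * padicValRat 3 (Dt.c : ℚ) ∧ Summit.BirchSwinnertonDyer.Rank1Residual.X11b.Three.Koly.CertificateAt Dt H.β ι 3 M

/-- Statement of `stub_leafRankZeroUpper_nonsplitRows` (NEW in v5): item 26024 `LeafRankZeroUpperAtThree` (the route's rank-`0` UPPER member U₀)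
RESTRICTED to the `3Nn` rows (`ρ̄_{W,3}` NOT onto; non-CM; on Gss2 the image is then exactly `C_ns⁺(3)`) — consumed at the rank-`0` twists
`Wd` of the `3Nn` rank-one rows, which are again `3Nn`. Weaker than 26024 (one more binder); the tower rows of 26024 are Kato-print and
are NOT asked. -/
def Sig.stub_leafRankZeroUpper_nonsplitRows : Prop :=
  ∀ (W : WeierstrassCurve ℚ) [W.IsElliptic] [W.IsGloballyMinimal], ¬ W.HasCM → Literature.NumberTheory.EllipticCurves.Rank1Residual.Addv W 3 → Summit.BirchSwinnertonDyer.Rank1Residual.Additive.SubGss W 3 → W.analyticRank = 0 → ¬ W.HasSurjectiveModNGaloisRep 3 → Literature.NumberTheory.EllipticCurves.Rank1Residual.Typed.MissingUpperBoundAt W 3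

/-! ### The registered stubs (theorems restating the `Sig.*` texts byte-identically) -/

/-- STUB (print, displayed) = item 27199: Gross–Zagier, Kolyvagin, Kolyvagin's Ш-index bound, GZK, modularity, newforms, Hoffstein–Luo,
Shimura reciprocity at conductor `1`, McCallum 1991 Cor. 5.6, Darmon 2004 Thm. 3.6, and Kato 2004 Thm. 14.5 (3) + Prop. 14.16 (2). Each
conjunct is a typed Literature fact of size XL with no `_holds`; this stub is never counted as progress. -/
theorem stub_pub :
  ((∀ (N : ℕ) [NeZero N] (W : WeierstrassCurve ℚ) (K : Type) [Field K] [NumberField K], Literature.NumberTheory.EllipticCurves.gross_zagier N W K) ∧ (∀ (N : ℕ) [NeZero N] (W : WeierstrassCurve ℚ) (K : Type) [Field K] [NumberField K], Literature.NumberTheory.EllipticCurves.kolyvagin N W K) ∧ (∀ (N : ℕ) [NeZero N] (W : WeierstrassCurve ℚ) (K : Type) [Field K] [NumberField K], Literature.NumberTheory.EllipticCurves.Kolyvagin1990_padicValNat_card_sha_le N W K) ∧ Literature.NumberTheory.EllipticCurves.rank_eq_analyticRank_of_analyticRank_le_one ∧ WeierstrassCurve.hasEntireLFunction_rat ∧ Literature.NumberTheory.EllipticCurves.ModularForms.exists_isNewformOf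 ∧ Literature.NumberTheory.EllipticCurves.HoffsteinLuo1997_exists_twist_L_one_ne_zero ∧ (∀ (N : ℕ) [NeZero N] (W : WeierstrassCurve ℚ) (K : Type) [Field K] [NumberField K], Literature.NumberTheory.EllipticCurves.heegnerPointOfConductor_one_galoisConj N W K) ∧ Literature.NumberTheory.EllipticCurves.McCallum1991_pow_dvd_card_sha_primary_of_certificate ∧ (∀ (N : ℕ) [NeZero N] (W : WeierstrassCurve ℚ) (K : Type) [Field K] [NumberField K], Literature.NumberTheory.EllipticCurves.phi_heegnerTau_mem_range_map_singularModuliField N W K)) ∧ Literature.NumberTheory.EllipticCurves.Kato2004.rankZero_padicValNat_sha_add_padicValNat_tamagawa_le_of_additive_potGood_of_imageContainsSL2 := by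
  sorry

/-- STUB (LOAD-BEARING crux = item 27200, McCallum currency, surj(3) rows): for every Gss2 rank-one 3-adic-tower row, SOME split Heegner frame
with SOME derived-point certificate `Koly.CertificateAt Dt H.β ι 3 M` of adjusted BSD depth `2M ≤ ord₃∏c(E) + ord₃∏c(Wd) + 2·ord₃ c(Dt)` — the
indivisibility half T1⁻ of the refined Kolyvagin conjecture at an additive `3`; per-pair certifiable (Jetchev–Lauter–Stein 2009 §4). OPEN. -/
theorem stub_existsMcCallumCertificate_towerRows :
  ∀ (W : WeierstrassCurve ℚ) [W.IsElliptic] [W.IsGloballyMinimal], Literature.NumberTheory.EllipticCurves.Rank1Residual.Addv W 3 → Summit.BirchSwinnertonDyer.Rank1Residual.Additive.SubGss W 3 → W.analyticRank = 1 → (∀ n : ℕ, W.HasSurjectiveModNGaloisRep (3 ^ n : ℕ)) → ∃ (N : ℕ) (_ : NeZero N) (K : Type) (_ : Field K) (_ : NumberField K) (Dt : Literature.NumberTheory.EllipticCurves.ModularForms.ModularParametrizationData W N) (H : Literature.NumberTheory.EllipticCurves.HeegnerDatum N (NumberField.discr K)) (ι : K →+* ℂ) (P : (W.baseChange K).toAffine.Point)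 (Wd : WeierstrassCurve ℚ) (_ : Wd.IsElliptic) (_ : Wd.IsGloballyMinimal) (Cd : WeierstrassCurve.VariableChange ℚ) (M : ℕ), W.conductorNorm ℤ = N ∧ Literature.NumberTheory.EllipticCurves.IsImaginaryQuadratic K ∧ Literature.NumberTheory.EllipticCurves.SatisfiesHeegnerHypothesis N K ∧ (W.quadraticTwist (NumberField.discr K : ℚ)).entireLFunction 1 ≠ 0 ∧ WeierstrassCurve.Affine.Point.map ι.toRatAlgHom P = Literature.NumberTheory.EllipticCurves.ModularForms.heegnerPointComplex Dt H ∧ Cd • W.quadraticTwist (NumberField.discr K : ℚ) = Wd ∧ (2 * M : ℤ) ≤ padicValNat 3 W.tamagawaProduct + padicValNat 3 Wd.tamagawaProduct + 2 * padicValRat 3 (Dt.c : ℚ) ∧ Summit.BirchSwinnertonDyer.Rank1Residual.X11b.Three.Koly.CertificateAt Dt H.β ι 3 M := by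
  sorry

/-- STUB (NEW, PRINT, displayed): Kolyvagin's structure theorem under IRREDUCIBILITY in certificate form = the tree's named fact
`MatarNekovar2019.thm07_pow_dvd_card_sha_primary_of_certificate_of_irreducible` BY NAME (size XL, no `_holds`; never counted as progress). -/
theorem stub_structIrr :
  Literature.NumberTheory.EllipticCurves.MatarNekovar2019.thm07_pow_dvd_card_sha_primary_of_certificate_of_irreducible := by
  sorry

/-- STUB (NEW, research = A₃ₙₙ): the certificate statement of A 27200 on the `3Nn` rows (`¬ CM`, `ρ̄_{E,3}` NOT onto) at an ODD-discriminant split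
frame — for every such Gss2 rank-one row SOME frame with SOME derived-point certificate of adjusted BSD depth. Same currency and instrument as
27200; OPEN (T1⁻ at an additive `3`). -/
theorem stub_existsMcCallumCertificate_nonsplitRows :
  ∀ (W : WeierstrassCurve ℚ) [W.IsElliptic] [W.IsGloballyMinimal], ¬ W.HasCM → Literature.NumberTheory.EllipticCurves.Rank1Residual.Addv W 3 → Summit.BirchSwinnertonDyer.Rank1Residual.Additive.SubGss W 3 → W.analyticRank = 1 → ¬ W.HasSurjectiveModNGaloisRep 3 → ∃ (N : ℕ) (_ : NeZero N) (K : Type) (_ : Field K) (_ : NumberField K) (Dt : Literature.NumberTheory.EllipticCurves.ModularForms.ModularParametrizationData W N) (H : Literature.NumberTheory.EllipticCurves.HeegnerDatum N (NumberField.discr K)) (ι : K →+* ℂ) (P : (W.baseChange K).toAffine.Point) (Wd : WeierstrassCurve ℚ) (_ : Wd.IsElliptic) (_ : Wd.IsGloballyMinimal) (Cd : WeierstrassCurve.VariableChange ℚ) (M : ℕ), W.conductorNorm ℤ = N ∧ Literature.NumberTheory.EllipticCurves.IsImaginaryQuadratic K ∧ Odd (NumberField.discr K) ∧ Literature.NumberTheory.EllipticCurves.SatisfiesHeegnerHypothesis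 N K ∧ (W.quadraticTwist (NumberField.discr K : ℚ)).entireLFunction 1 ≠ 0 ∧ WeierstrassCurve.Affine.Point.map ι.toRatAlgHom P = Literature.NumberTheory.EllipticCurves.ModularForms.heegnerPointComplex Dt H ∧ Cd • W.quadraticTwist (NumberField.discr K : ℚ) = Wd ∧ (2 * M : ℤ) ≤ padicValNat 3 W.tamagawaProduct + padicValNat 3 Wd.tamagawaProduct + 2 * padicValRat 3 (Dt.c : ℚ) ∧ Summit.BirchSwinnertonDyer.Rank1Residual.X11b.Three.Koly.CertificateAt Dt H.β ι 3 M := by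
  sorry

/-- STUB (NEW in v5) = item 26024 `LeafRankZeroUpperAtThree` RESTRICTED to the `3Nn` rank-`0` rows (`ρ̄_{W,3}` not onto): the rank-`0` UPPER
member U₀ of the route exactly where it is NOT in print (Kato 2004 (12.5.2) `SL₂(ℤ₃) ⊆ image` fails; `EulerSystemBigImageBarrier`); 53 classes
of the census (`N < 5·10⁵`). The ONE separated half the Heegner-pair method cannot supply on the `3Nn` rows (memo IRREDUCIBLE-ROAD §6). OPEN. -/
theorem stub_leafRankZeroUpper_nonsplitRows :
  ∀ (W : WeierstrassCurve ℚ) [W.IsElliptic] [W.IsGloballyMinimal], ¬ W.HasCM → Literature.NumberTheory.EllipticCurves.Rank1Residual.Addv W 3 → Summit.BirchSwinnertonDyer.Rank1Residual.Additive.SubGss W 3 → W.analyticRank = 0 → ¬ W.HasSurjectiveModNGaloisRep 3 → Literature.NumberTheory.EllipticCurves.Rank1Residual.Typed.MissingUpperBoundAt W 3 := by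
  sorry

/-! ### The composition -/

/-- **A quadratic twist of a `3Nn` curve is `3Nn`** (any model): if `ρ̄_{W,3}` is not onto then neither is `ρ̄_{Cd • W^{(d)},3}` (`d ≠ 0`).
The twist relation read backwards (`exists_variableChange_quadraticTwist_symm`: `W ≅ C′ • (Cd • W^{(d)})^{(d)}`) and surjectivity transported
along a sign-twisted isomorphism (`twistAdmissible_hasSurjectiveModNGaloisRep_smul_quadraticTwist`: `ρ̄_{E^d,3} ≅ ρ̄_{E,3} ⊗ χ_d`, `−1 = J²`).
[cite: SilvermanAEC2009, X.5 Cor. 5.4 and X.2 Prop. 2.4] -/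
theorem not_hasSurjectiveModNGaloisRep_three_of_smul_quadraticTwist_eq (W : WeierstrassCurve ℚ) [W.IsElliptic] {d : ℚ} (hd : d ≠ 0)
    (Wd : WeierstrassCurve ℚ) [Wd.IsElliptic] (Cd : WeierstrassCurve.VariableChange ℚ) (hWd : Cd • W.quadraticTwist d = Wd)
    (hs : ¬ W.HasSurjectiveModNGaloisRep 3) : ¬ Wd.HasSurjectiveModNGaloisRep 3 := by
  haveI : Fact (Nat.Prime 3) := ⟨Nat.prime_three⟩
  intro hsd
  obtain ⟨C', hC'⟩ :=
    Summit.BirchSwinnertonDyer.Rank1Residual.Additive.exists_variableChange_quadraticTwist_symm Wd W hd ⟨Cd, hWd⟩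
  have h := Summit.BirchSwinnertonDyer.BirchSwinnertonDyer.Theorems.twistAdmissible_hasSurjectiveModNGaloisRep_smul_quadraticTwist
    Wd hd C' 3 hsd
  rw [hC'] at h
  exact hs h

/-- The kernel-checked composition BY NAME (type literally the route decl): split on `ρ̄_{E,3}` onto. ONTO ⟹ the 3-adic tower
(`RamifiedPairLowerBound.towerSurj_three_of_subGss_of_surj`, p622801) ⟹ the McCallum road p618012 §12 on the witness of `stub_existsMcCallumCertificate_towerRows`
with the eight named facts it consumes projected out of `stub_pub` (the twist's upper half there = Kato Tamagawa-exact, PRINT). NOT ONTO ⟹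
`stub_existsMcCallumCertificate_nonsplitRows` gives an odd split frame and a certificate; the twist `Wd` is on the leaf (`RamifiedPairUpperBound.leaf_twist_of_heegner`)
with `r_an(Wd) = 0` and is again `3Nn` (`not_hasSurjectiveModNGaloisRep_three_of_smul_quadraticTwist_eq`), so `stub_leafRankZeroUpper_nonsplitRows` gives
`MissingUpperBoundAt Wd 3`; the irreducible road p624620 §8 (`…_of_structIrrCertificate_of_upperTwist`, structure theorem = `stub_structIrr`) gives L₁(E). -/
theorem Gss2LowerAtThreeRankOne_of (hpub : Sig.stub_pub) (hC : Sig.stub_existsMcCallumCertificate_towerRows) (hMN : Sig.stub_structIrr)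
    (hC3 : Sig.stub_existsMcCallumCertificate_nonsplitRows) (hU0 : Sig.stub_leafRankZeroUpper_nonsplitRows) :
    Summit.BirchSwinnertonDyer.BirchSwinnertonDyer.Theses.RamifiedHeegnerPair.Gss2LowerAtThreeRankOne := by
  obtain ⟨⟨hGZ, hKo, -, hGZK, hmod, -, -, hrec, hMc, h36⟩, hKatoT⟩ := hpub
  intro W _ _ hCM hadd hsub hr
  haveI : Fact (Nat.Prime 3) := ⟨Nat.prime_three⟩
  by_cases hs : W.HasSurjectiveModNGaloisRep 3
  · exact Summit.BirchSwinnertonDyer.BirchSwinnertonDyer.Theorems.RamifiedPairLowerBound.gssLowerAtThree_rankOne_towerRows_of_exists_mccallumCertificate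
      hGZ hKo hKatoT hGZK hmod hrec h36 hMc hC W hadd hsub hr
      (Summit.BirchSwinnertonDyer.BirchSwinnertonDyer.Theorems.RamifiedPairLowerBound.towerSurj_three_of_subGss_of_surj W hadd hsub hs)
  · obtain ⟨N, hN0, K, _, _, Dt, H, ι, P, Wd, _, _, Cd, M, hN, hK, hodd, hHN, hLt, hP, hWd, hM, hcert⟩ := hC3 W hCM hadd hsub hr hs
    haveI : NeZero N := hN0
    subst hN
    obtain ⟨hCMd, haddd, hsubd, -⟩ :=
      Summit.BirchSwinnertonDyer.BirchSwinnertonDyer.Theorems.RamifiedPairUpperBound.leaf_twist_of_heegner W hCM hadd hsub K hK hHN hodd Wd Cd hWd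
    have hD0 : (NumberField.discr K : ℚ) ≠ 0 := by exact_mod_cast NumberField.discr_ne_zero K
    haveI hEt : (W.quadraticTwist (NumberField.discr K : ℚ)).IsElliptic := W.isElliptic_quadraticTwist hD0
    have hLt' : (W.quadraticTwist (NumberField.discr K : ℚ)).entireLFunction = Wd.entireLFunction := by
      rw [← hWd, WeierstrassCurve.entireLFunction_smul]
    have hLd1 : Wd.entireLFunction 1 ≠ 0 := by rw [← hLt']; exact hLt
    have hrd : Wd.analyticRank = 0 := (Wd.analyticRank_eq_zero_iff_holds (hmod Wd)).2 hLd1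
    have hsd : ¬ Wd.HasSurjectiveModNGaloisRep 3 := not_hasSurjectiveModNGaloisRep_three_of_smul_quadraticTwist_eq W hD0 Wd Cd hWd hs
    have hUd : Literature.NumberTheory.EllipticCurves.Rank1Residual.Typed.MissingUpperBoundAt Wd 3 := hU0 Wd hCMd haddd hsubd hrd hsd
    exact Summit.BirchSwinnertonDyer.BirchSwinnertonDyer.Theorems.RamifiedPairLowerBound.missingLowerBoundAt_three_rankOne_gss_of_structIrrCertificate_of_upperTwist
      W K Dt H ι P (hGZ _ W K) (hKo _ W K) hGZK hmod (hrec _ W K) (h36 _ W K) hMN hCM hadd hsub hr hK hHN hP hLt Wd Cd hWd hUd hcert hM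

/-- The crux from the (sorried) stubs — shows the skeleton is complete. -/
theorem Gss2LowerAtThreeRankOne_holds_of_stubs :
    Summit.BirchSwinnertonDyer.BirchSwinnertonDyer.Theses.RamifiedHeegnerPair.Gss2LowerAtThreeRankOne :=
  Gss2LowerAtThreeRankOne_of stub_pub stub_existsMcCallumCertificate_towerRows stub_structIrr stub_existsMcCallumCertificate_nonsplitRows
    stub_leafRankZeroUpper_nonsplitRows

end Summit.BirchSwinnertonDyer.BirchSwinnertonDyer.Cruxes.Gss2LowerAtThreeRankOne.KolyvaginSplit

end
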